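import Literature.AnabelianGeometry.EtaleTheta.SettingModelTateSemidirect
import Literature.AnabelianGeometry.EtaleTheta.SettingModelTwistConjCentre
import Literature.AnabelianGeometry.EtaleTheta.SettingModelChiDeltaTheta
import HarnessLib

/-!
# The stage-2 («Tate shear») root model of [EtTh] §1 (R78) — theta-quotient kernels in coordinates and
# `Δ_Θ(curveχq) ≅ Ẑ(χ)`, χ-equivariantly

Mochizuki, *The étale theta function …*, Publ. RIMS **45** (2009) [EtTh], §1, PRIMS PDF p. 12
[cite: MochizukiEtTh2009, §1 p.12]: "`(Ẑ(1) ≅) Δ_Θ`". Layer L2 of the abc-iut cell (seat abc-iut-L6-d6 gen 4; R78-MAP #5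
item F1q). The stage-2 carrier `curveχq p i j` of abc-iut-w5-d249 (`SettingModelTateSemidirect.lean`:
`Π^tp_X := Γ ⋊ G_{ℚ_p}` for the AFFINE action `actχq p i j = affTwist₃ ∘ cocyclePairHom p i j` — `a ↦ b^{κ_p^i}·(a·b^{κ_p^j})·…`,
`b ↦ b^{χ}` — of abc-iut-L2-t6 / abc-iut-L2-t5) is treated EXACTLY like the stage-1 carrier `curveχ p` in
abc-iut-L2-d1's `SettingModelChiLevelKernels.lean` and this seat's `SettingModelChiDeltaTheta.lean`, through the
generic centre law of `SettingModelTwistConjCentre.lean` (`GfpTwist.*`, hypothesis `hφ0` := abc-iut-w5-d249's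
`hHat_gfpFst_actχq_of_gfpSnd_eq_one`: on degree zero the stage-2 action IS the diagonal twist):

* `thetaKerχq_normal`, `ellKerχq_normal` — the re-keyed `Normal` instances (abbrev-curve pitfall);
* `mem_thetaKerχq_iff` / `mem_ellKerχq_iff` — the kernels `Ker(Π^tp_X ↠ (Π^tp_X)^Θ)`, `Ker(Π^tp_X ↠ (Π^tp_X)^ell)` of
  `curveχq` in level coordinates (`(∀ N, ĥ_N = 1) ∧ g_G = 1`, resp. `x = y = 0`);
* `cThetaχq : Ẑ →ₜ* (Π^tp_X)^Θ`, `cThetaχq_injective`, `exists_cThetaχq_eq_of_mem_ker`,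
  **`conj_cThetaχq : g · c^t · g⁻¹ = c^{χ(aug^Θ g)·t}`** — the shear acts TRIVIALLY on the centre;
* `deltaThetaCoordχq : Ẑ →* Δ_Θ(curveχq)`, continuous, bijective, **`deltaThetaCoordχq_chi`** (the
  `KummerCore.coeffHom_smul` shape for the stage-2 Kummer file F6q).

SEMI-SYNTHETIC MODEL (Tate-module type Galois action on `Δ^ell`, still not the tempered `π₁` of a curve); class (b)
construction over the frozen interface (2 small defs + 2 re-keyed `Normal` instances on the NEW carrier); consistency
evidence only; nothing of [EtTh] is asserted; no side is taken on [IUTchIII] Cor. 3.12.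
-/

noncomputable section

open Topology

namespace Literature.AnabelianGeometry.EtaleTheta.SettingModel

open Literature.AnabelianGeometry.SemiGraphs
open Function
open scoped commutatorElement

variable (p : ℕ) [Fact p.Prime] (i j : ℤ)

/-! ### Instance keys and the kernels of `curveχq` in level coordinates -/

/-- `Ker(Π^tp_X ↠ (Π^tp_X)^Θ) ⊴ Π^tp_X` at the stage-2 model (re-keyed generic instance — `curveχq` is an `abbrev`).
[cite: MochizukiEtTh2009, §1 p.12] -/
instance thetaKerχq_normal : (CurveTheta.thetaKer (curveχq p i j)).Normal := CurveTheta.thetaKer_normal _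

/-- `Ker(Π^tp_X ↠ (Π^tp_X)^ell) ⊴ Π^tp_X` at the stage-2 model (re-keyed). [cite: MochizukiEtTh2009, §1 p.12] -/
instance ellKerχq_normal : (CurveTheta.ellKer (curveχq p i j)).Normal := CurveTheta.ellKer_normal _

/-- `Δ_X = inl(F̂₂)` as the image of `⊤`. [cite: MochizukiEtTh2009, §1 p.12] -/
theorem deltaHatχq_eq_map_inl :
    (curveχq p i j).DeltaHat = (⊤ : Subgroup F₂hatT).map (SemidirectProduct.inl : F₂hatT →* PiHtχq p i j) := by
  rw [deltaHatχq_eq, ← SemidirectProduct.range_inl_eq_ker_rightHom, MonoidHom.range_eq_map]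

/-- `inl : F̂₂ → Π_X` is a closed embedding at the stage-2 model. [cite: MochizukiEtTh2009, §1 p.12] -/
theorem isClosedEmbedding_inlHatχq : IsClosedEmbedding (SemidirectProduct.inl : F₂hatT → PiHtχq p i j) :=
  (Semidirect.continuous_inl (isInducing_leftRightHatχq p i j)).isClosedEmbedding SemidirectProduct.inl_injective

/-- For a closed-embedding homomorphism, `Subgroup.map` commutes with topological closure. [folklore] -/
private theorem map_topologicalClosure_of_isClosedEmbeddingq {A B : Type*} [Group A] [Group B] [TopologicalSpace A]
    [TopologicalSpace B] [IsTopologicalGroup A] [IsTopologicalGroup B] (f : A →* B) (hf : IsClosedEmbedding f)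
    (H : Subgroup A) : (H.map f).topologicalClosure = (H.topologicalClosure).map f := by
  apply SetLike.coe_injective
  rw [Subgroup.topologicalClosure_coe, Subgroup.coe_map, Subgroup.coe_map, Subgroup.topologicalClosure_coe,
    hf.closure_image_eq]

/-- Membership in `toHat⁻¹(inl(S)⁻)` in coordinates. [cite: MochizukiEtTh2009, §1 p.12] -/
private theorem mem_comap_closure_map_inlq_iff (S : Subgroup F₂hatT) (g : PiTpχq p i j) :
    (curveχq p i j).toHat g ∈ (S.map (SemidirectProduct.inl : F₂hatT →* PiHtχq p i j)).topologicalClosure ↔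
      gfpFst g.left ∈ S.topologicalClosure ∧ g.right = 1 := by
  rw [map_topologicalClosure_of_isClosedEmbeddingq _ (isClosedEmbedding_inlHatχq p i j)]
  constructor
  · rintro ⟨a, ha, hag⟩
    have h1 := congrArg SemidirectProduct.left hag
    have h2 := congrArg SemidirectProduct.right hag
    simp only [SemidirectProduct.left_inl, SemidirectProduct.right_inl] at h1 h2
    change a = (toHatχq p i j g).left at h1
    change (1 : GQp p) = (toHatχq p i j g).right at h2
    rw [toHatχq_left] at h1
    rw [toHatχq_right] at h2
    exact ⟨h1 ▸ ha, h2.symm⟩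
  · rintro ⟨h1, h2⟩
    refine ⟨gfpFst g.left, h1, ?_⟩
    change SemidirectProduct.inl (gfpFst g.left) = toHatχq p i j g
    ext
    · simp
    · simp [h2]

/-- **`Ker(Π^tp_X ↠ (Π^tp_X)^Θ)` of `curveχq` in coordinates.** [cite: MochizukiEtTh2009, §1 p.12] -/
theorem mem_thetaKerχq_iff (g : PiTpχq p i j) :
    g ∈ CurveTheta.thetaKer (curveχq p i j) ↔ (∀ N : ℕ+, hHat N (gfpFst g.left) = 1) ∧ g.right = 1 := by
  have h0 : g ∈ CurveTheta.thetaKer (curveχq p i j) ↔ (curveχq p i j).toHat g ∈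
      (⁅⁅(curveχq p i j).DeltaHat, (curveχq p i j).DeltaHat⁆, (curveχq p i j).DeltaHat⁆).topologicalClosure :=
    Iff.rfl
  rw [h0, deltaHatχq_eq_map_inl, ← Subgroup.map_commutator, ← Subgroup.map_commutator,
    mem_comap_closure_map_inlq_iff, mem_closure_commutator₃_iff_forall_hHat]

/-- **`Ker(Π^tp_X ↠ (Π^tp_X)^ell)` of `curveχq` in coordinates.** [cite: MochizukiEtTh2009, §1 p.12] -/
theorem mem_ellKerχq_iff (g : PiTpχq p i j) :
    g ∈ CurveTheta.ellKer (curveχq p i j) ↔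
      (∀ N : ℕ+, (hHat N (gfpFst g.left)).x = 0 ∧ (hHat N (gfpFst g.left)).y = 0) ∧ g.right = 1 := by
  have h0 : g ∈ CurveTheta.ellKer (curveχq p i j) ↔ (curveχq p i j).toHat g ∈
      (⁅(curveχq p i j).DeltaHat, (curveχq p i j).DeltaHat⁆).topologicalClosure := Iff.rfl
  rw [h0, deltaHatχq_eq_map_inl, ← Subgroup.map_commutator, mem_comap_closure_map_inlq_iff,
    mem_closure_commutator₂_iff_forall_hHat]

/-! ### The coordinate `t ↦ c^t` into `(Π^tp_X)^Θ` of the stage-2 model -/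

/-- **`c^· : Ẑ → (Π^tp_X)^Θ`** of the stage-2 model: the image of `t ↦ inl(c^t, 0)` (`cGfpχ`, stage-agnostic).
[cite: MochizukiEtTh2009, §1 p.12] -/
def cThetaχq : ZH →ₜ* CurveTheta.GTheta (curveχq p i j) where
  toMonoidHom := ((CurveTheta.toTheta (curveχq p i j)).comp
    (SemidirectProduct.inl : Gfp →* PiTpχq p i j)).comp cGfpχ.toMonoidHom
  continuous_toFun :=
    (CurveTheta.continuous_toTheta (curveχq p i j)).comp ((continuous_inlχq p i j).comp cGfpχ.continuous)

/-- [cite: MochizukiEtTh2009, §1 p.12] -/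
theorem cThetaχq_apply (t : ZH) :
    cThetaχq p i j t = CurveTheta.toTheta (curveχq p i j) (SemidirectProduct.inl (cGfpχ t)) := rfl

/-- `c^t ∈ Δ_Θ`. [cite: MochizukiEtTh2009, §1 p.12] -/
theorem cThetaχq_mem_ker (t : ZH) : cThetaχq p i j t ∈ (CurveTheta.thetaToEll (curveχq p i j)).ker := by
  rw [cThetaχq_apply, CurveTheta.mk_mem_ker_thetaToEll_iff, mem_ellKerχq_iff]
  refine ⟨fun N => ?_, SemidirectProduct.right_inl _⟩
  rw [SemidirectProduct.left_inl, gfpFst_cGfpχ, hHat_apply_of_cPowSpec _ powHat_commutator_spec]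
  exact ⟨rfl, rfl⟩

/-- Two elements of `Π^tp_X` with trivial `G`-component and `F̂₂`-components congruent modulo `[[F̂₂,F̂₂],F̂₂]⁻` have
the same image in `(Π^tp_X)^Θ`. [cite: MochizukiEtTh2009, §1 p.12] -/
theorem toThetaq_eq_of_right_eq_one (x y : PiTpχq p i j) (hx : x.right = 1) (hy : y.right = 1)
    (h : gfpFst x.left * (gfpFst y.left)⁻¹ ∈
      (⁅⁅(⊤ : Subgroup F₂hatT), (⊤ : Subgroup F₂hatT)⁆, (⊤ : Subgroup F₂hatT)⁆).topologicalClosure) :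
    CurveTheta.toTheta (curveχq p i j) x = CurveTheta.toTheta (curveχq p i j) y := by
  rw [CurveTheta.toTheta, QuotientGroup.mk'_apply, QuotientGroup.mk'_apply, QuotientGroup.eq_iff_div_mem,
    mem_thetaKerχq_iff]
  have hr : (x / y).right = 1 := by
    simp only [div_eq_mul_inv, SemidirectProduct.mul_right, SemidirectProduct.inv_right, hx, hy, inv_one, mul_one]
  refine ⟨fun N => ?_, hr⟩
  have hl : gfpFst (x / y).left = gfpFst x.left * (gfpFst y.left)⁻¹ := by
    simp only [div_eq_mul_inv, SemidirectProduct.mul_left, SemidirectProduct.inv_left, hx, hy, inv_one, map_one,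
      MulAut.one_apply, map_mul, map_inv]
  rw [hl]
  exact (mem_closure_commutator₃_iff_forall_hHat _).mp h N

/-- **`cThetaχq` is injective.** [cite: MochizukiEtTh2009, §1 p.12] -/
theorem cThetaχq_injective : Injective (cThetaχq p i j) := by
  intro t t' h
  rw [cThetaχq_apply, cThetaχq_apply, CurveTheta.toTheta, QuotientGroup.mk'_apply, QuotientGroup.mk'_apply,
    QuotientGroup.eq_iff_div_mem, mem_thetaKerχq_iff] at h
  obtain ⟨h1, -⟩ := h
  have hl : gfpFst ((SemidirectProduct.inl (cGfpχ t) : PiTpχq p i j) / SemidirectProduct.inl (cGfpχ t')).left =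
      powHat (eta ⁅FreeGroup.of (0 : Fin 2), FreeGroup.of 1⁆) t *
        (powHat (eta ⁅FreeGroup.of (0 : Fin 2), FreeGroup.of 1⁆) t')⁻¹ := by
    rw [div_eq_mul_inv, ← map_inv, ← map_mul, SemidirectProduct.left_inl, map_mul, map_inv, gfpFst_cGfpχ,
      gfpFst_cGfpχ]
  have hmem : powHat (eta ⁅FreeGroup.of (0 : Fin 2), FreeGroup.of 1⁆) (t * t'⁻¹) ∈
      (⁅⁅(⊤ : Subgroup F₂hatT), (⊤ : Subgroup F₂hatT)⁆, (⊤ : Subgroup F₂hatT)⁆).topologicalClosure := by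
    rw [map_mul, map_inv, ← hl, mem_closure_commutator₃_iff_forall_hHat]
    exact h1
  have := eq_one_of_cPow_mem_closure₃ _ powHat_commutator_spec hmem
  rwa [mul_inv_eq_one] at this

/-- **`cThetaχq` maps ONTO `Δ_Θ`.** [cite: MochizukiEtTh2009, §1 p.12] -/
theorem exists_cThetaχq_eq_of_mem_ker {d : CurveTheta.GTheta (curveχq p i j)}
    (hd : d ∈ (CurveTheta.thetaToEll (curveχq p i j)).ker) : ∃ t : ZH, cThetaχq p i j t = d := by
  obtain ⟨g, rfl⟩ := QuotientGroup.mk_surjective d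
  have hg : g ∈ CurveTheta.ellKer (curveχq p i j) := (CurveTheta.mk_mem_ker_thetaToEll_iff (curveχq p i j) g).mp hd
  obtain ⟨hxy, hr⟩ := (mem_ellKerχq_iff p i j g).mp hg
  have hcl : gfpFst g.left ∈ (⁅(⊤ : Subgroup F₂hatT), (⊤ : Subgroup F₂hatT)⁆).topologicalClosure :=
    (mem_closure_commutator₂_iff_forall_hHat _).mpr hxy
  obtain ⟨t, ht, -⟩ := exists_mul_inv_cPow_mem_closure₃ _ powHat_commutator_spec hcl
  refine ⟨t, ?_⟩
  rw [cThetaχq_apply]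
  symm
  exact toThetaq_eq_of_right_eq_one p i j g _ hr (SemidirectProduct.right_inl _) (by simpa using ht)

/-- **Conjugation on `Δ_Θ` of the stage-2 model is the cyclotomic character** — the shear part of the affine action
acts trivially on the centre: `g · c^t · g⁻¹ = c^{χ(aug^Θ g)·t}` for every `g ∈ (Π^tp_X)^Θ`.
[cite: MochizukiEtTh2009, §1 p.12] -/
theorem conj_cThetaχq (g : CurveTheta.GTheta (curveχq p i j)) (t : ZH) :
    g * cThetaχq p i j t * g⁻¹ = cThetaχq p i j (chi p (CurveTheta.augTheta (curveχq p i j) g) t) := by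
  obtain ⟨x, rfl⟩ := QuotientGroup.mk_surjective g
  have haug : CurveTheta.augTheta (curveχq p i j) (QuotientGroup.mk x : CurveTheta.GTheta (curveχq p i j)) =
      x.right := by
    change CurveTheta.augTheta (curveχq p i j) (CurveTheta.toTheta (curveχq p i j) x) = _
    rw [CurveTheta.augTheta_toTheta]
    rfl
  rw [haug, cThetaχq_apply, cThetaχq_apply, CurveTheta.toTheta, QuotientGroup.mk'_apply, QuotientGroup.mk'_apply,
    ← QuotientGroup.mk_mul, ← QuotientGroup.mk_inv, ← QuotientGroup.mk_mul]
  change CurveTheta.toTheta (curveχq p i j) _ = CurveTheta.toTheta (curveχq p i j) _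
  refine toThetaq_eq_of_right_eq_one p i j _ _ (GfpTwist.right_conj_inl p _ x _) (SemidirectProduct.right_inl _) ?_
  rw [SemidirectProduct.left_inl, gfpFst_cGfpχ]
  exact GfpTwist.conj_inl_cPow_mul_inv_mem_closure₃ p (actχq p i j) (hHat_gfpFst_actχq_of_gfpSnd_eq_one p i j)
    _ powHat_commutator_spec x t

/-! ### Packaged: `Ẑ ≅ Δ_Θ(curveχq)`, continuous, χ-equivariant -/

/-- **`Ẑ → Δ_Θ(curveχq)`**, `t ↦ c^t`, cod-restricted. [cite: MochizukiEtTh2009, §1 p.12] -/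
def deltaThetaCoordχq : ZH →* (CurveTheta.thetaToEll (curveχq p i j)).ker :=
  (cThetaχq p i j).toMonoidHom.codRestrict _ (cThetaχq_mem_ker p i j)

/-- [cite: MochizukiEtTh2009, §1 p.12] -/
@[simp] theorem coe_deltaThetaCoordχq (t : ZH) :
    ((deltaThetaCoordχq p i j t : (CurveTheta.thetaToEll (curveχq p i j)).ker) : CurveTheta.GTheta (curveχq p i j)) =
      cThetaχq p i j t := rfl

/-- `t ↦ c^t : Ẑ → Δ_Θ` is continuous. [cite: MochizukiEtTh2009, §1 p.12] -/
theorem continuous_deltaThetaCoordχq : Continuous (deltaThetaCoordχq p i j) :=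
  (cThetaχq p i j).continuous.subtype_mk _

/-- **`t ↦ c^t : Ẑ → Δ_Θ(curveχq)` is bijective.** [cite: MochizukiEtTh2009, §1 p.12] -/
theorem bijective_deltaThetaCoordχq : Bijective (deltaThetaCoordχq p i j) := by
  constructor
  · intro t t' h
    exact cThetaχq_injective p i j (congrArg Subtype.val h)
  · rintro ⟨d, hd⟩
    obtain ⟨t, ht⟩ := exists_cThetaχq_eq_of_mem_ker p i j hd
    exact ⟨t, Subtype.ext ht⟩

/-- **χ-equivariance** at the stage-2 model, in the shape of `ThetaSetting.KummerCore.coeffHom_smul`.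
[cite: MochizukiEtTh2009, §1 p.12] -/
theorem deltaThetaCoordχq_chi (g : CurveTheta.GTheta (curveχq p i j)) (t : ZH) :
    deltaThetaCoordχq p i j (chi p (CurveTheta.augTheta (curveχq p i j) g) t) =
      MulAut.conjNormal g (deltaThetaCoordχq p i j t) := by
  apply Subtype.ext
  rw [MulAut.conjNormal_apply, coe_deltaThetaCoordχq, coe_deltaThetaCoordχq, conj_cThetaχq]

end Literature.AnabelianGeometry.EtaleTheta.SettingModel

end
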